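import Summits.SmoothPoincare4.SmoothPoincare4.Theorems.SymplecticOrigamiGromovRecognitionRelEndStubFlatLeavesAux
import Summits.SmoothPoincare4.SmoothPoincare4.Theorems.SymplecticOrigamiGromovRecognitionRelEndStubFlatLeavesAux2
import Summits.SmoothPoincare4.SmoothPoincare4.Theorems.SymplecticOrigamiGromovRecognitionRelEndStubFlatLeavesAux5
import Literature.Geometry.Symplectic.AlmostComplexStructure
import Literature.Geometry.Symplectic.JHolomorphicOn
import Mathlib.Geometry.Manifold.LocalDiffeomorph
import Mathlib

/-!
# The sphere at infinity `H∞` of the wedge cap as a two-chart `JX`-holomorphic sphere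
(helper `helper_wedgeSphereH` of line `cross-cap-laurent`, crux `GromovRecognitionRelEnd`,
item stmt-SmoothPoincare4-11009)

In the wedge cap `X` with its almost complex structure `JX`, which in the cap charts
`ηH : {|(p₂, p₃)| < R₁⁻¹} → X` and `ηC : {|(p₀, p₁)| < R₁⁻¹, |(p₂, p₃)| < R₁⁻¹} → X` is the product
structure `i ⊕ i` (`JX ∘ dη = dη ∘ rot`, `rot q = (-q₁, q₀, -q₃, q₂)`), with the gluing clause
`ηC (w, t) = ηH (1/w, t)` for `w ≠ 0` (complex inversion of the first factor), the sphere at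
infinity `H∞ = ηH (ℂ × 0) ∪ {ηC 0}` is exhibited in the tree's two-chart form: `C^∞` maps
`u v : ℂ → X` with `v w = u w⁻¹` for `w ≠ 0`, both `JX`-holomorphic
(`Literature.Geometry.Symplectic.IsJHolomorphic`), `u z = ηH (z, 0)` and `v 0 = ηC 0`.

Construction (as for the flat leaves, files `…StubFlatLeavesAux2/4/5`): `u = ηH ∘ s` for the slice
`s z = (z, 0, 0)` (a `JX`-holomorphic slice of the holomorphic chart `ηH`,
`FlatLeaves.isJHolomorphic_comp_slice`), and `v z = u (1/z)` for `z ≠ 0`, `v 0 = ηC (s 0) = ηC 0`;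
near `0` the gluing clause gives `v = ηC ∘ s` (`FlatLeaves.inv1_sliceH`: the first inversion acts on
the slice as `z ↦ 1/z`), so `v` is `C^∞` (`FlatLeaves.contMDiff_inversionGlue`) and `JX`-holomorphic
at `0` (slice computation for `ηC`), while on `{z ≠ 0}` it is the holomorphic reparametrisation
`u ∘ (z ↦ 1/z)` (`IsJHolomorphicOn.comp`); `JX`-holomorphicity is a pointwise condition on the
differential, transported along these local identities (`Filter.EventuallyEq.mfderiv_eq`).

Everything is proved; no definition, no named fact.

References: M. Gromov, *Pseudo holomorphic curves in symplectic manifolds*, Invent. Math. 82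
(1985), 2.4.A₁′ [Gromov1985]; C. Hummel, *Gromov's compactness theorem for pseudo-holomorphic
curves* (1997), Ch. I §3 (3.1) [Hummel1997]; D. McDuff, D. Salamon, *J-holomorphic Curves and
Symplectic Topology*, 2nd ed. (2012), §4.2 (spheres through the two charts `z`, `1/z`)
[McDuffSalamon2012].
-/

noncomputable section

-- the registered namespace `Summit.SmoothPoincare4.SmoothPoincare4.Theorems…` repeats a component
set_option linter.dupNamespace false

open scoped Manifold ContDiff Topology
open Set Function Filter Literature.Geometry.Symplectic

namespace Summit.SmoothPoincare4.SmoothPoincare4.Theorems.GromovRecognitionRelEnd.CrossCapLaurent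

namespace WedgeSphereH

/-- **`J`-holomorphicity at a point is a local condition**: if `f = g` near `t` and
`dg_t (i ζ) = J_{g t} (dg_t ζ)` for all `ζ`, then `df_t (i ζ) = J_{f t} (df_t ζ)`
(`mfderiv` only depends on the germ). [folklore] -/
theorem mfderiv_mul_I_congr_of_eventuallyEq {E' : Type*} [NormedAddCommGroup E'] [NormedSpace ℝ E']
    {H' : Type*} [TopologicalSpace H'] {I' : ModelWithCorners ℝ E' H'} {X : Type*}
    [TopologicalSpace X] [ChartedSpace H' X]
    {J : ∀ y : X, TangentSpace I' y →L[ℝ] TangentSpace I' y} {f g : ℂ → X} {t : ℂ}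
    (hfg : f =ᶠ[𝓝 t] g)
    (hg : ∀ ζ : ℂ, mfderiv 𝓘(ℝ, ℂ) I' g t (Complex.I * ζ) = J (g t) (mfderiv 𝓘(ℝ, ℂ) I' g t ζ))
    (ζ : ℂ) :
    mfderiv 𝓘(ℝ, ℂ) I' f t (Complex.I * ζ) = J (f t) (mfderiv 𝓘(ℝ, ℂ) I' f t ζ) := by
  rw [hfg.mfderiv_eq, hfg.eq_of_nhds]
  exact hg ζ

/-- **The chart at infinity `z ↦ u (1/z)` of a `J`-holomorphic sphere is `J`-holomorphic off `0`**:
if `u` is `C^∞` and `J`-holomorphic and `v = u ∘ (z ↦ 1/z)` on `ℂ ∖ {0}`, then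
`dv_t (i ζ) = J (dv_t ζ)` at every `t ≠ 0` (holomorphic reparametrisation, Hummel 1997, (3.1)).
[cite: Hummel1997, Ch. I §3, Definition and eq. (3.1)] -/
theorem mfderiv_mul_I_of_eq_comp_inv {E' : Type*} [NormedAddCommGroup E'] [NormedSpace ℝ E']
    {H' : Type*} [TopologicalSpace H'] {I' : ModelWithCorners ℝ E' H'} {X : Type*}
    [TopologicalSpace X] [ChartedSpace H' X]
    {J : ∀ y : X, TangentSpace I' y →L[ℝ] TangentSpace I' y} {u v : ℂ → X}
    (hu : ContMDiff 𝓘(ℝ, ℂ) I' ∞ u) (hJ : IsJHolomorphic I' J u)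
    (huv : ∀ w : ℂ, w ≠ 0 → v w = u w⁻¹) {t : ℂ} (ht : t ≠ 0) (ζ : ℂ) :
    mfderiv 𝓘(ℝ, ℂ) I' v t (Complex.I * ζ) = J (v t) (mfderiv 𝓘(ℝ, ℂ) I' v t ζ) := by
  have hcomp : IsJHolomorphicOn I' J (u ∘ fun w : ℂ => w⁻¹) {w : ℂ | w ≠ 0} :=
    (hJ.isJHolomorphicOn univ).comp isOpen_ne differentiableOn_inv (mapsTo_univ _ _)
      fun z _ => hu.mdifferentiableAt (by simp)
  have hE : v =ᶠ[𝓝 t] (u ∘ fun w : ℂ => w⁻¹) := by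
    filter_upwards [isOpen_ne.mem_nhds ht] with w hw
    exact huv w hw
  exact mfderiv_mul_I_congr_of_eventuallyEq hE (fun ξ => hcomp t ht ξ) ζ

end WedgeSphereH

open CapModel FlatLeaves WedgeSphereH in
/-- **Registered helper `helper_wedgeSphereH`** (line `cross-cap-laurent`, signature verbatim): the
sphere at infinity `H∞` of the wedge cap as a two-chart `JX`-holomorphic sphere `ℂ ∪_{1/z} ℂ → X`,
`u z = ηH (z, 0)`, `v w = u (1/w)` (`w ≠ 0`), `v 0 = ηC 0` (Gromov 1985, 2.4.A₁′: the spheres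
`S₁ = S² × s₂`, `S₂ = s₁ × S²` of the split structure; McDuff–Salamon 2012, §4.2). See the file
header for the construction. [cite: Gromov1985, 2.4.A₁′] -/
theorem helper_wedgeSphereH : ∀ (X : Type) [TopologicalSpace X] [ChartedSpace (EuclideanSpace ℝ (Fin 4)) X] [IsManifold (𝓡 4) ∞ X] (JX : Literature.Geometry.Symplectic.AlmostComplexStructure (𝓡 4) ∞ X) (R₁ : ℝ) (ηH ηC : EuclideanSpace ℝ (Fin 4) → X), 0 < R₁ → IsLocalDiffeomorphOn 𝓘(ℝ, EuclideanSpace ℝ (Fin 4)) (𝓡 4) ∞ ηH {p : EuclideanSpace ℝ (Fin 4) | p 2 ^ 2 + p 3 ^ 2 < R₁⁻¹ ^ 2} → (∀ p : EuclideanSpace ℝ (Fin 4), p 2 ^ 2 + p 3 ^ 2 < R₁⁻¹ ^ 2 → ∀ q : EuclideanSpace ℝ (Fin 4), JX (ηH p) (mfderiv 𝓘(ℝ, EuclideanSpace ℝ (Fin 4)) (𝓡 4) ηH p q) = mfderiv 𝓘(ℝ, EuclideanSpace ℝ (Fin 4)) (𝓡 4) ηH p (WithLp.toLp 2 ![-(q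 1), q 0, -(q 3), q 2])) → IsLocalDiffeomorphOn 𝓘(ℝ, EuclideanSpace ℝ (Fin 4)) (𝓡 4) ∞ ηC {p : EuclideanSpace ℝ (Fin 4) | p 0 ^ 2 + p 1 ^ 2 < R₁⁻¹ ^ 2 ∧ p 2 ^ 2 + p 3 ^ 2 < R₁⁻¹ ^ 2} → (∀ p : EuclideanSpace ℝ (Fin 4), p 0 ^ 2 + p 1 ^ 2 < R₁⁻¹ ^ 2 → p 2 ^ 2 + p 3 ^ 2 < R₁⁻¹ ^ 2 → (p 0 ≠ 0 ∨ p 1 ≠ 0) → ηC p = ηH (WithLp.toLp 2 ![p 0 / (p 0 ^ 2 + p 1 ^ 2), -(p 1) / (p 0 ^ 2 + p 1 ^ 2), p 2, p 3])) → (∀ p : EuclideanSpace ℝ (Fin 4), p 0 ^ 2 + p 1 ^ 2 < R₁⁻¹ ^ 2 → p 2 ^ 2 + p 3 ^ 2 < R₁⁻¹ ^ 2 → ∀ q : EuclideanSpace ℝ (Fin 4), JX (ηC p) (mfderiv 𝓘(ℝ, EuclideanSpace ℝ (Fin 4)) (𝓡 4) ηC p q) = mfderiv 𝓘(ℝ,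 EuclideanSpace ℝ (Fin 4)) (𝓡 4) ηC p (WithLp.toLp 2 ![-(q 1), q 0, -(q 3), q 2])) → ∃ u v : ℂ → X, ContMDiff 𝓘(ℝ, ℂ) (𝓡 4) ∞ u ∧ ContMDiff 𝓘(ℝ, ℂ) (𝓡 4) ∞ v ∧ (∀ w : ℂ, w ≠ 0 → v w = u w⁻¹) ∧ Literature.Geometry.Symplectic.IsJHolomorphic (𝓡 4) (fun y => JX y) u ∧ Literature.Geometry.Symplectic.IsJHolomorphic (𝓡 4) (fun y => JX y) v ∧ (∀ z : ℂ, u z = ηH (WithLp.toLp 2 ![z.re, z.im, 0, 0])) ∧ v 0 = ηC 0 := by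
  intro X _ _ _ JX R₁ ηH ηC hR₁ hHloc hHhol hCloc hCH hChol
  -- linear algebra of `ℝ⁴ = ℂ²`: the slice inclusion `ζ ↦ (ζ, 0, 0)` intertwines `i` with `I4`
  obtain ⟨T, hT, hTI⟩ := exists_clm_slice01
  -- the two coordinate domains
  set DH : Set (EuclideanSpace ℝ (Fin 4)) :=
    {p : EuclideanSpace ℝ (Fin 4) | p 2 ^ 2 + p 3 ^ 2 < R₁⁻¹ ^ 2} with hDH
  set DC : Set (EuclideanSpace ℝ (Fin 4)) :=
    {p : EuclideanSpace ℝ (Fin 4) | p 0 ^ 2 + p 1 ^ 2 < R₁⁻¹ ^ 2 ∧ p 2 ^ 2 + p 3 ^ 2 < R₁⁻¹ ^ 2}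
    with hDC
  have hR : (0 : ℝ) < R₁⁻¹ ^ 2 := by positivity
  -- the slice `s t = (t, 0, 0)` and its coordinates
  set s : ℂ → EuclideanSpace ℝ (Fin 4) := fun t => WithLp.toLp 2 ![t.re, t.im, 0, 0] with hs
  have hs_fd : ∀ t, HasFDerivAt s T t := hasFDerivAt_slice01 hT 0 0
  have hs0 : ∀ t, s t 0 = t.re := fun t => by simp [hs]
  have hs1 : ∀ t, s t 1 = t.im := fun t => by simp [hs]
  have hs2 : ∀ t, s t 2 = 0 := fun t => by simp [hs]
  have hs3 : ∀ t, s t 3 = 0 := fun t => by simp [hs]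
  have hsDH : ∀ t, s t ∈ DH := fun t => by
    show s t 2 ^ 2 + s t 3 ^ 2 < R₁⁻¹ ^ 2
    rw [hs2, hs3]; simpa using hR
  have hsDC : ∀ t : ℂ, Complex.normSq t < R₁⁻¹ ^ 2 → s t ∈ DC := fun t ht =>
    ⟨by show r1 (s t) < R₁⁻¹ ^ 2; rw [hs, r1_sliceH]; exact ht, hsDH t⟩
  have hs00 : s 0 = 0 := by
    ext i
    fin_cases i <;> simp [hs]
  have h0C : s 0 ∈ DC := hsDC 0 (by simpa using hR)
  have hinv1s : ∀ t, inv1 (s t) = s t⁻¹ := fun t => inv1_sliceH _ _ t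
  -- the first affine chart `u = ηH ∘ s`
  set u : ℂ → X := fun t => ηH (s t) with hu
  have hHD : ∀ p ∈ DH, ContMDiffAt 𝓘(ℝ, EuclideanSpace ℝ (Fin 4)) (𝓡 4) ∞ ηH p := fun p hp =>
    contMDiffAt_of_mem hHloc hp
  have hu_smooth : ContMDiff 𝓘(ℝ, ℂ) (𝓡 4) ∞ u := contMDiff_comp_slice hHD hs_fd hsDH
  have hu_hol : IsJHolomorphic (𝓡 4) (fun y => JX y) u :=
    isJHolomorphic_comp_slice (JX := fun y => JX y)
      (fun p hp => (hHD p hp).mdifferentiableAt (by simp))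
      (fun p hp q => hHhol p hp q) hs_fd hTI hsDH
  -- the second affine chart `v = u (1/t)`, `v 0 = ηC (s 0) = ηC 0`
  set v : ℂ → X := fun t => if t = 0 then ηC (s 0) else u t⁻¹ with hv
  have hCt : ∀ t : ℂ, Complex.normSq t < R₁⁻¹ ^ 2 → t ≠ 0 → ηC (s t) = u t⁻¹ := by
    intro t ht ht0
    have h01 : s t 0 ≠ 0 ∨ s t 1 ≠ 0 := by
      rw [hs0, hs1]
      by_contra hc
      simp only [not_or, not_not] at hc
      exact ht0 (Complex.ext hc.1 hc.2)
    rw [hCH (s t) (hsDC t ht).1 (hsDC t ht).2 h01]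
    show ηH (inv1 (s t)) = ηH (s t⁻¹)
    rw [hinv1s]
  have hCD0 : ContMDiffAt 𝓘(ℝ, EuclideanSpace ℝ (Fin 4)) (𝓡 4) ∞ ηC (s 0) :=
    contMDiffAt_of_mem hCloc h0C
  have hC0s : ContMDiffAt 𝓘(ℝ, ℂ) (𝓡 4) ∞ (fun t => ηC (s t)) 0 :=
    hCD0.comp 0 (contDiff_of_hasFDerivAt_const hs_fd).contMDiff.contMDiffAt
  have hagree : ∀ᶠ t in 𝓝 (0 : ℂ), t ≠ 0 → ηC (s t) = u t⁻¹ :=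
    (eventually_normSq_lt hR).mono fun t ht ht0 => hCt t ht ht0
  have hv_smooth : ContMDiff 𝓘(ℝ, ℂ) (𝓡 4) ∞ v := contMDiff_inversionGlue hu_smooth hC0s hagree
  have huv : ∀ t : ℂ, t ≠ 0 → v t = u t⁻¹ := fun t ht => if_neg ht
  have hv0' : v 0 = ηC (s 0) := if_pos rfl
  have hv0 : v 0 = ηC 0 := by rw [hv0', hs00]
  -- near `0`, `v` is the slice `ηC ∘ s` of the holomorphic chart `ηC`
  have hvE : v =ᶠ[𝓝 0] fun t => ηC (s t) := by
    filter_upwards [hagree] with t ht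
    by_cases ht0 : t = 0
    · subst ht0
      exact hv0'
    · rw [huv t ht0]
      exact (ht ht0).symm
  have hC_hol0 : ∀ ζ : ℂ, mfderiv 𝓘(ℝ, ℂ) (𝓡 4) (fun t => ηC (s t)) 0 (Complex.I * ζ) =
      (fun y => JX y) (ηC (s 0)) (mfderiv 𝓘(ℝ, ℂ) (𝓡 4) (fun t => ηC (s t)) 0 ζ) := by
    intro ζ
    have hd : MDifferentiableAt 𝓘(ℝ, EuclideanSpace ℝ (Fin 4)) (𝓡 4) ηC (s 0) :=
      hCD0.mdifferentiableAt (by simp)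
    rw [mfderiv_comp_slice_apply (hs_fd 0) hd, mfderiv_comp_slice_apply (hs_fd 0) hd, hTI]
    exact (hChol _ h0C.1 h0C.2 (T ζ)).symm
  have hv_hol : IsJHolomorphic (𝓡 4) (fun y => JX y) v := by
    intro t ζ
    by_cases ht : t = 0
    · subst ht
      exact mfderiv_mul_I_congr_of_eventuallyEq hvE hC_hol0 ζ
    · exact mfderiv_mul_I_of_eq_comp_inv hu_smooth hu_hol huv ht ζ
  exact ⟨u, v, hu_smooth, hv_smooth, huv, hu_hol, hv_hol, fun z => rfl, hv0⟩

end Summit.SmoothPoincare4.SmoothPoincare4.Theorems.GromovRecognitionRelEnd.CrossCapLaurent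

end
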